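import Summits.ABC.StewartYu.PadicG3VbPack
import HarnessLib

set_option linter.dupNamespace false

/-!
# Crux `Y07Odd` (stmt-ABC-19658), line `gen3-slab-odd` — registered stub `stub_ineqsV` (the `m = 0` inequality pack)

`Summits/ABC/ABC/Theorems/PadicPrimesKummerThirdY07OddStubIneqsV.lean` — cell `abc-stewartyu` (seat p3-g7; lead p2-g4).  The registered stub
`stub_ineqsV` of the skeleton `Lines/gen3-slab-odd.lean`, VERBATIM: under the crux context and the `m = 0` parameter record, for some box scale
`b ≥ 1` (here `b = 1`) the record's named inequalities `IneqPackR₃ S (P.schedVb b)` hold — `Summit.ABC.StewartYu.G3Setup.ineqPackR₃_schedVb_one`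
(`PadicG3VbPack`: (B1) lp-1's `startCountR₂_schedVb_one`, order `E` p2's `expLine_V` on p1's `headline_V100_div_log_lit`, k-step families
`kstep_line_Vb`, half-step `half_line_Vb`, sizes `PadicG3VbSizes*`/`Budget`/`Half*` with the sharp `ψ(H) ≤ (23/20)H`).  No named fact.
-/

namespace Summit.ABC.ABC.Theorems

/-- **Registered stub `stub_ineqsV`** of the skeleton `Lines/gen3-slab-odd.lean` (crux `Y07Odd`): the `m = 0` branch of the record's named
inequalities, at the box scale `b = 1`. [cite: Nesterenko2003, Prop 4.1, Lemma 4.3, §4.3; shape only] -/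
theorem stub_ineqsV : ∀ (p : ℕ) [Fact p.Prime], p ≠ 2 → ∀ (S : Summit.ABC.StewartYu.G3Setup p), 2 ≤ S.n →
    ∀ (V : Fin S.n → ℝ) (Vmax W : ℝ),
    (∀ j, padicValRat p (S.α j) = 0) →
    (∀ κ : Fin S.n → ℤ, (∃ γ : ℚ, ∏ j, S.α j ^ κ j = γ ^ 2 ∨ ∏ j, S.α j ^ κ j = -γ ^ 2) → ∀ j, (2 : ℤ) ∣ κ j) →
    (∀ j, Height.logHeight₁ (S.α j) ≤ V j) → (∀ j, 1 ≤ V j) → (∀ j, V j ≤ Vmax) →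
    (∀ j, Real.log (max 3 (|S.b j| : ℝ)) ≤ W) → 1 ≤ W →
    ¬ (padicValRat p (∏ j, S.α j ^ S.b j - 1) : ℝ) * Real.log p ≤
        ((2 : ℝ) ^ 100) ^ S.n * ((p : ℝ) / Real.log p) * (∏ j, V j) * (W + Real.log p + Real.log (2 * Vmax)) →
    ∀ (P : Summit.ABC.StewartYu.PadicG3Par S.n), P.p = p → P.A = V → P.Amax ≤ Vmax → P.Amax ≤ 2 ^ S.n * (∏ j, V j) → P.W = W →
      P.Nq = P.K → P.K₀ = p - 1 → P.θ₀ = 1 / 2 →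
      P.m = 0 → ∃ b : ℝ, 1 ≤ b ∧ S.IneqPackR₃ (P.schedVb b) := by
  intro p _ _ S hn2 V Vmax W _ _ hV hV1 _ hWb _ hU P hPp hPA hAmaxV hAmaxPr hPW hNq hK₀ hθ hm
  exact S.ineqPackR₃_schedVb_one hn2 V Vmax W hV hV1 hWb hU P hPp hPA hAmaxV hAmaxPr hPW hNq hK₀ hθ hm

end Summit.ABC.ABC.Theorems
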